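import Summits.Ventures.YMGap.Thresholds.LatticeBakryEmeryPolarisation

/-!
# Group convolution with polynomial approximate identities on `SU(N)^ι`

TREE-SHAPED LIFT (cell `ym-beyond`, HUMAN RULINGS D-0035 / D-0037): part 2 of 3 of seat ym-beyond-p4 g8's
`HOME/LIFT-P4Y2-LatticeBakryEmeryC2Density.lean` (sha16 dc5fd6e06aaf8b9f, referee PASS baseline v0.8 §5g7), split at its own
section boundaries to meet the 400-line rule; filed by the cell's literature seat (ym-beyond-lit g3) on P4's WANTED N5(b)
(P4 has no filing rights). Bodies verbatim; namespace `Summit.Ventures.YMGap.LatticeBakryEmery` as intended by P4.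

CONTENT (= the lift file's §2 A–D): A. polynomial approximate identities (`exists_poly_uniform_near` from the tree's
Stone–Weierstrass `polyAlg_separatesPoints`, `exists_poly_approxIdentity` via Urysohn); B. right translates of polynomials are
polynomials (`coefA`, `coordFn_mul_right`, `mcoef`, `monom_mul_right`, `integral_poly_mul_mem`); C. the group convolution
`polyConv k S := Q ↦ ∫ k(Q·emb h) S(emb h⁻¹) dHaar` (`polyConv_mem`, `expG`, `integral_kernel_translate`, right-translation covariance
`polyConv_mul_exp` from LEFT Haar invariance); D. differentiation along one-parameter subgroups (`hasDerivAt_integral_flow`,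
`algD_algD_polyConv`: `D_V D_V (k ⋆ S)(emb x) = ∫ k(emb(xh)) D_V D_V S(emb h⁻¹)`, `polyConv_apply`).  Consumer:
`LatticeBakryEmeryC2Density`.  No `Prop` is declared; nothing about Yang–Mills is asserted.  References: Peter–Weyl density of
representative functions (D. Applebaum, Probability on Compact Lie Groups (2014) Thm 2.2.4; Bröcker–tom Dieck III §3). [folklore]
-/

noncomputable section

open scoped Matrix ComplexConjugate BigOperators Matrix.Norms.Frobenius ContDiff Topology
open Matrix Complex Finset MeasureTheory Filter
open Literature.MathematicalPhysics.QuantumFieldTheory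
open Literature.MathematicalPhysics.QuantumFieldTheory.SUNBakryEmery (SUN FrameIdx frame expSU coe_expSU coordFn coordMat CoordIdx
  coordFn_true coordFn_false re_trace_mul_eq_sum)

namespace Summit.Ventures.YMGap

namespace LatticeBakryEmery

open Summit.Ventures.YMGap.SharpClustering

universe u

variable {ι : Type u} [Fintype ι] [DecidableEq ι] {N : ℕ}

open Literature.MathematicalPhysics.QuantumFieldTheory.SUNBakryEmery (expSU coe_expSU coordFn coordMat CoordIdx
  coordFn_true coordFn_false re_trace_mul_eq_sum)

/-! #### A. Polynomial approximate identities (Stone–Weierstrass + Urysohn) -/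

omit [DecidableEq ι] in
/-- C⁰-density of polynomials on `SU(N)^ι` (tree Stone–Weierstrass `polyAlg_separatesPoints`): every continuous
function is uniformly `η`-close to the restriction of a polynomial. [folklore] -/
theorem exists_poly_uniform_near (φ : C(PSU ι N, ℝ)) {η : ℝ} (hη : 0 < η) :
    ∃ (n : ℕ) (p : Cfg ι N → ℝ), p ∈ polySpace ι N n ∧ ∀ g : PSU ι N, |p (emb g) - φ g| < η := by
  have hSW : (polyAlg ι N).topologicalClosure = ⊤ :=
    ContinuousMap.subalgebra_topologicalClosure_eq_top_of_separatesPoints _ polyAlg_separatesPoints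
  have hmem : φ ∈ closure ((polyAlg ι N : Subalgebra ℝ C(PSU ι N, ℝ)) : Set C(PSU ι N, ℝ)) := by
    rw [← Subalgebra.topologicalClosure_coe, hSW]; exact Algebra.mem_top
  obtain ⟨f, hf, hd⟩ := Metric.mem_closure_iff.1 hmem η hη
  obtain ⟨n, p, rfl⟩ := exists_resPoly_eq_of_mem_polyAlg hf
  refine ⟨n, p.1, p.2, fun g => ?_⟩
  have h1 : dist (φ g) (resPoly n p g) ≤ dist φ (resPoly n p) := ContinuousMap.dist_apply_le_dist g
  rw [Real.dist_eq] at h1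
  rw [abs_sub_comm]
  exact h1.trans_lt hd

omit [DecidableEq ι] in
/-- **Polynomial approximate identities on `SU(N)^ι`**: for every open neighbourhood `U` of `1` and `η > 0` there
is a polynomial `k`, nonnegative on the group, of Haar integral `1`, with Haar mass `≤ η` outside `U`. [folklore] -/
theorem exists_poly_approxIdentity {U : Set (PSU ι N)} (hUo : IsOpen U) (h1U : (1 : PSU ι N) ∈ U) {η : ℝ}
    (hη : 0 < η) :
    ∃ (n : ℕ) (k : Cfg ι N → ℝ), k ∈ polySpace ι N n ∧ (∀ g : PSU ι N, 0 ≤ k (emb g)) ∧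
      (∫ g, k (emb g) ∂(haarPi ι N)) = 1 ∧
      (∫ g, Uᶜ.indicator (fun g => k (emb g)) g ∂(haarPi ι N)) ≤ η := by
  set μ := haarPi ι N
  -- an Urysohn bump at `1` supported in `U`
  obtain ⟨φ, hφ0, hφ1, hφI⟩ := exists_continuous_zero_one_of_isClosed hUo.isClosed_compl
    (isClosed_singleton (x := (1 : PSU ι N)))
    (Set.disjoint_singleton_right.2 fun h => h h1U)
  have hφnn : ∀ g, 0 ≤ φ g := fun g => (hφI g).1
  have hφone : φ 1 = 1 := hφ1 rfl
  have hIpos : 0 < ∫ g, φ g ∂μ :=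
    φ.continuous.integral_pos_of_hasCompactSupport_nonneg_nonzero (HasCompactSupport.of_compactSpace _)
      (fun g => hφnn g) (by rw [hφone]; exact one_ne_zero)
  set I := ∫ g, φ g ∂μ with hI
  -- Stone–Weierstrass approximant of the bump, shifted up to be nonnegative
  set δ : ℝ := η * I / 4 with hδ
  have hδpos : 0 < δ := by positivity
  obtain ⟨n, q, hq, hqφ⟩ := exists_poly_uniform_near φ hδpos
  set k₀ : Cfg ι N → ℝ := q + fun _ => δ with hk₀
  have hk₀app : ∀ Q, k₀ Q = q Q + δ := fun Q => rfl
  have hk₀mem : k₀ ∈ polySpace ι N n := (polySpace ι N n).add_mem hq (const_mem_polySpace n δ)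
  have hk₀ge : ∀ g, φ g ≤ k₀ (emb g) := by
    intro g; have h := hqφ g; rw [abs_lt] at h; rw [hk₀app]; linarith
  have hk₀le : ∀ g, k₀ (emb g) ≤ φ g + 2 * δ := by
    intro g; have h := hqφ g; rw [abs_lt] at h; rw [hk₀app]; linarith
  have hk₀nn : ∀ g, 0 ≤ k₀ (emb g) := fun g => (hφnn g).trans (hk₀ge g)
  have hk₀cont : Continuous fun g : PSU ι N => k₀ (emb g) := continuous_restrict (contDiff_of_mem_polySpace hk₀mem)
  have hk₀int : Integrable (fun g : PSU ι N => k₀ (emb g)) μ := integrable_of_continuous_PSU hk₀cont μ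
  set J := ∫ g, k₀ (emb g) ∂μ with hJ
  have hIJ : I ≤ J := integral_mono (integrable_of_continuous_PSU φ.continuous μ) hk₀int fun g => hk₀ge g
  have hJpos : 0 < J := hIpos.trans_le hIJ
  have hJinv : 0 ≤ J⁻¹ := inv_nonneg.2 hJpos.le
  -- tail of `k₀` outside `U` is at most `2δ`
  have hUc : MeasurableSet Uᶜ := hUo.isClosed_compl.measurableSet
  have htail₀ : ∫ g, Uᶜ.indicator (fun g => k₀ (emb g)) g ∂μ ≤ 2 * δ := by
    have hpt : ∀ g, Uᶜ.indicator (fun g => k₀ (emb g)) g ≤ 2 * δ := by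
      intro g
      by_cases hg : g ∈ Uᶜ
      · rw [Set.indicator_of_mem hg]; have h := hk₀le g; have h0 : φ g = 0 := hφ0 hg; linarith
      · rw [Set.indicator_of_notMem hg]; positivity
    calc ∫ g, Uᶜ.indicator (fun g => k₀ (emb g)) g ∂μ ≤ ∫ _g, (2 * δ) ∂μ :=
          integral_mono (hk₀int.indicator hUc) (integrable_const _) hpt
      _ = 2 * δ := by simp [μ]
  -- normalise
  refine ⟨n, J⁻¹ • k₀, (polySpace ι N n).smul_mem J⁻¹ hk₀mem, ?_, ?_, ?_⟩
  · intro g; exact mul_nonneg hJinv (hk₀nn g)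
  · show ∫ g, J⁻¹ * k₀ (emb g) ∂μ = 1
    rw [integral_const_mul, ← hJ, inv_mul_cancel₀ hJpos.ne']
  · have hfun : (fun g => Uᶜ.indicator (fun g => (J⁻¹ • k₀) (emb g)) g) =
        fun g => J⁻¹ * Uᶜ.indicator (fun g => k₀ (emb g)) g := by
      funext g
      by_cases hg : g ∈ Uᶜ
      · rw [Set.indicator_of_mem hg, Set.indicator_of_mem hg]; rfl
      · rw [Set.indicator_of_notMem hg, Set.indicator_of_notMem hg, mul_zero]
    rw [hfun, integral_const_mul]
    calc J⁻¹ * ∫ g, Uᶜ.indicator (fun g => k₀ (emb g)) g ∂μ ≤ J⁻¹ * (2 * δ) :=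
          mul_le_mul_of_nonneg_left htail₀ hJinv
      _ = (η / 2) * (J⁻¹ * I) := by rw [hδ]; ring
      _ ≤ (η / 2) * 1 := by
          refine mul_le_mul_of_nonneg_left ?_ (by positivity)
          rw [inv_mul_le_iff₀ hJpos, mul_one]; exact hIJ
      _ ≤ η := by linarith

/-! #### B. Right translates of polynomials are polynomials; polynomiality of the convolution -/

/-- Transition coefficients of the real coordinates under right multiplication:
`coordFn c (X M) = Σ_{c'} coefA c M c' · coordFn c' X`. -/
private def coefA (c : CoordIdx N) (M : Matrix (Fin N) (Fin N) ℂ) : CoordIdx N → ℝ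
  | (a, b, true) => ((M * coordMat c) b a).re
  | (a, b, false) => -((M * coordMat c) b a).im

omit [Fintype ι] [DecidableEq ι] in
/-- `coordFn c (X M) = Σ_{c'} coefA c M c' · coordFn c' X`. [folklore] -/
theorem coordFn_mul_right (c : CoordIdx N) (X M : Matrix (Fin N) (Fin N) ℂ) :
    coordFn c (X * M) = ∑ c' : CoordIdx N, coefA c M c' * coordFn c' X := by
  unfold coordFn
  rw [Matrix.mul_assoc, re_trace_mul_eq_sum, Fintype.sum_prod_type]
  refine sum_congr rfl fun a _ => ?_
  rw [Fintype.sum_prod_type]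
  refine sum_congr rfl fun b _ => ?_
  rw [Fintype.sum_bool]
  simp only [coefA]
  change _ = _ * coordFn (a, b, true) X + _ * coordFn (a, b, false) X
  rw [coordFn_true, coordFn_false]
  ring

omit [Fintype ι] [DecidableEq ι] in
/-- Continuity of the transition coefficients in `M`. [folklore] -/
theorem continuous_coefA (c c' : CoordIdx N) : Continuous fun M : Matrix (Fin N) (Fin N) ℂ => coefA c M c' := by
  obtain ⟨a, b, s⟩ := c'
  have hM : Continuous fun M : Matrix (Fin N) (Fin N) ℂ => (M * coordMat c) b a :=
    (continuous_id.matrix_mul continuous_const).matrix_elem b a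
  cases s
  · exact (Complex.continuous_im.comp hM).neg
  · exact Complex.continuous_re.comp hM

/-- The coefficient of the re-indexed monomial `τ` in the expansion of `monom κs (Q B)`. -/
private def mcoef {k : ℕ} (κs : Fin k → PCoordIdx ι N) (τ : Fin k → CoordIdx N) (B : Cfg ι N) : ℝ :=
  ∏ j, coefA (κs j).2 (B (κs j).1) (τ j)

omit [Fintype ι] [DecidableEq ι] in
/-- **Right translates of monomials**: `monom κs (Q B) = Σ_τ mcoef κs τ B · monom (e_j, τ_j)_j Q`. [folklore] -/
theorem monom_mul_right {k : ℕ} (κs : Fin k → PCoordIdx ι N) (Q B : Cfg ι N) :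
    monom κs (Q * B) = ∑ τ : Fin k → CoordIdx N, mcoef κs τ B * monom (fun j => ((κs j).1, τ j)) Q := by
  simp only [monom, pcoordFn_apply, Pi.mul_apply, coordFn_mul_right, mcoef]
  rw [Fintype.prod_sum]
  refine sum_congr rfl fun τ _ => ?_
  rw [← prod_mul_distrib]

omit [Fintype ι] [DecidableEq ι] in
/-- Continuity of `h ↦ mcoef κs τ (emb h)`. [folklore] -/
theorem continuous_mcoef_emb {k : ℕ} (κs : Fin k → PCoordIdx ι N) (τ : Fin k → CoordIdx N) :
    Continuous fun h : PSU ι N => mcoef κs τ (emb h) :=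
  continuous_finsetProd _ fun _ _ =>
    (continuous_coefA _ _).comp ((continuous_apply _).comp continuous_emb)

omit [DecidableEq ι] in
/-- **Polynomiality of group convolutions with polynomial kernels**: for `k ∈ 𝒫_n` and continuous `w`,
`Q ↦ ∫ k(Q · emb h) w(h) dσ^{⊗ι}(h)` lies in `𝒫_n`. [folklore] -/
theorem integral_poly_mul_mem {n : ℕ} {k : Cfg ι N → ℝ} (hk : k ∈ polySpace ι N n) {w : PSU ι N → ℝ}
    (hw : Continuous w) :
    (fun Q => ∫ h, k (Q * emb h) * w h ∂(haarPi ι N)) ∈ polySpace ι N n := by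
  set μ := haarPi ι N
  obtain ⟨c, hc⟩ := (Submodule.mem_span_range_iff_exists_fun ℝ).1 hk
  -- pointwise expansion of the integrand as a finite sum of (coefficient × monomial)
  have hexp : ∀ Q h, k (Q * emb h) * w h =
      ∑ i : (Σ k : Fin (n + 1), (Fin k → PCoordIdx ι N)), ∑ τ : Fin i.1 → CoordIdx N,
        (c i * mcoef i.2 τ (emb h) * w h) * monom (fun j => ((i.2 j).1, τ j)) Q := by
    intro Q h
    rw [← hc, Finset.sum_apply, sum_mul]
    refine sum_congr rfl fun i _ => ?_
    rw [Pi.smul_apply, smul_eq_mul, monom_mul_right, mul_sum, sum_mul]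
    refine sum_congr rfl fun τ _ => ?_
    ring
  have hint : ∀ (i : (Σ k : Fin (n + 1), (Fin k → PCoordIdx ι N))) (τ : Fin i.1 → CoordIdx N) (Q : Cfg ι N),
      Integrable (fun h => (c i * mcoef i.2 τ (emb h) * w h) * monom (fun j => ((i.2 j).1, τ j)) Q) μ :=
    fun i τ Q => integrable_of_continuous_PSU
      (((continuous_const.mul (continuous_mcoef_emb _ _)).mul hw).mul continuous_const) μ
  have hfun : (fun Q => ∫ h, k (Q * emb h) * w h ∂μ) =
      ∑ i : (Σ k : Fin (n + 1), (Fin k → PCoordIdx ι N)), ∑ τ : Fin i.1 → CoordIdx N,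
        (∫ h, c i * mcoef i.2 τ (emb h) * w h ∂μ) • monom (fun j => ((i.2 j).1, τ j)) := by
    funext Q
    simp_rw [hexp Q]
    rw [integral_finsetSum _ fun i _ => integrable_finsetSum _ fun τ _ => hint i τ Q, Finset.sum_apply]
    refine sum_congr rfl fun i _ => ?_
    rw [integral_finsetSum _ fun τ _ => hint i τ Q, Finset.sum_apply]
    refine sum_congr rfl fun τ _ => ?_
    rw [integral_mul_const, Pi.smul_apply, smul_eq_mul]
  rw [hfun]
  exact Submodule.sum_mem _ fun i _ => Submodule.sum_mem _ fun τ _ =>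
    Submodule.smul_mem _ _ (monom_mem (Nat.lt_succ_iff.1 i.1.2) _)

/-! #### C. The group convolution and its covariance under right translation -/

/-- **Group convolution with a kernel `k`**: `(k ⋆ S)(Q) := ∫ k(Q · emb h) S(emb h⁻¹) dσ^{⊗ι}(h)` (an ambient function of
`Q ∈ (ι → M_N(ℂ))`; on the group it is the usual convolution `∫ k(x h) S(h⁻¹) dh`). -/
noncomputable def polyConv (k S : Cfg ι N → ℝ) : Cfg ι N → ℝ := fun Q => ∫ h, k (Q * emb h) * S (emb h⁻¹) ∂(haarPi ι N)

omit [DecidableEq ι] in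
/-- `k ⋆ S ∈ 𝒫_n` for `k ∈ 𝒫_n` and smooth `S`. [folklore] -/
theorem polyConv_mem {n : ℕ} {k : Cfg ι N → ℝ} (hk : k ∈ polySpace ι N n) {S : Cfg ι N → ℝ} (hS : ContDiff ℝ ∞ S) :
    polyConv k S ∈ polySpace ι N n :=
  integral_poly_mul_mem hk (hS.continuous.comp (continuous_emb.comp continuous_inv))

/-- The one-parameter subgroup of `SU(N)^ι` generated by `V ∈ 𝔰𝔲(N)^ι`. -/
private noncomputable def expG (V : Cfg ι N) (hV : ∀ e, (V e)ᴴ = -V e) (hV0 : ∀ e, (V e).trace = 0) (t : ℝ) : PSU ι N :=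
  fun e => expSU (hV e) (hV0 e) t

omit [DecidableEq ι] in
/-- `emb (expG V t) = exp(tV)` in the product algebra. [folklore] -/
theorem emb_expG (V : Cfg ι N) (hV : ∀ e, (V e)ᴴ = -V e) (hV0 : ∀ e, (V e).trace = 0) (t : ℝ) :
    emb (expG V hV hV0 t) = NormedSpace.exp (t • V) := by
  rw [show NormedSpace.exp (t • V) = fun i => NormedSpace.exp ((t • V) i) from Pi.exp_def _]
  funext e
  simp [emb, expG, Pi.smul_apply]

omit [DecidableEq ι] in
/-- Normalisation is translation invariant: `∫ k(emb x · emb h) dh = ∫ k(emb h) dh`. [folklore] -/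
theorem integral_kernel_translate (k : Cfg ι N → ℝ) (x : PSU ι N) :
    ∫ h, k (emb x * emb h) ∂(haarPi ι N) = ∫ h, k (emb h) ∂(haarPi ι N) := by
  simp_rw [← emb_mul]
  exact integral_mul_left_eq_self (fun h => k (emb h)) x

omit [DecidableEq ι] in
/-- **Right-translation covariance of the convolution** (left invariance of Haar measure):
`(k ⋆ S)(Q e^{tV}) = ∫ k(Q · emb h) S(emb h⁻¹ · e^{tV}) dh` for `V ∈ 𝔰𝔲(N)^ι`. [folklore] -/
theorem polyConv_mul_exp (k S : Cfg ι N → ℝ) (Q V : Cfg ι N) (hV : ∀ e, (V e)ᴴ = -V e)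
    (hV0 : ∀ e, (V e).trace = 0) (t : ℝ) :
    polyConv k S (Q * NormedSpace.exp (t • V)) =
      ∫ h, k (Q * emb h) * S (emb h⁻¹ * NormedSpace.exp (t • V)) ∂(haarPi ι N) := by
  set u := expG V hV hV0 t with hu
  have hue : NormedSpace.exp (t • V) = emb u := (emb_expG V hV hV0 t).symm
  have h1 : ∀ h : PSU ι N, k (Q * NormedSpace.exp (t • V) * emb h) * S (emb h⁻¹) =
      (fun h' : PSU ι N => k (Q * emb h') * S (emb (h'⁻¹ * u))) (u * h) := by
    intro h
    show _ = k (Q * emb (u * h)) * S (emb ((u * h)⁻¹ * u))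
    rw [_root_.mul_inv_rev, inv_mul_cancel_right, emb_mul, hue, mul_assoc]
  unfold polyConv
  simp_rw [h1]
  rw [integral_mul_left_eq_self (fun h' : PSU ι N => k (Q * emb h') * S (emb (h'⁻¹ * u))) u]
  simp_rw [emb_mul, ← hue]

/-! #### D. Differentiating the convolution along one-parameter subgroups -/

omit [DecidableEq ι] in
/-- Differentiation under the integral sign along the flow `s ↦ emb h⁻¹ e^{sV}`. [folklore] -/
theorem hasDerivAt_integral_flow {F : Cfg ι N → ℝ} (hF : ContDiff ℝ ∞ F) {K : PSU ι N → ℝ} (hK : Continuous K)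
    (V : Cfg ι N) (s₀ : ℝ) :
    HasDerivAt (fun s => ∫ h, K h * F (emb h⁻¹ * NormedSpace.exp (s • V)) ∂(haarPi ι N))
      (∫ h, K h * algD V F (emb h⁻¹ * NormedSpace.exp (s₀ • V)) ∂(haarPi ι N)) s₀ := by
  set μ := haarPi ι N
  set Φ : ℝ → PSU ι N → ℝ := fun s h => K h * F (emb h⁻¹ * NormedSpace.exp (s • V)) with hΦ
  set Φ' : ℝ → PSU ι N → ℝ := fun s h => K h * algD V F (emb h⁻¹ * NormedSpace.exp (s • V)) with hΦ'
  have hexp : Continuous fun t : ℝ => NormedSpace.exp (t • V) :=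
    NormedSpace.exp_continuous.comp (continuous_id.smul continuous_const)
  have hei : Continuous fun h : PSU ι N => emb h⁻¹ := continuous_emb.comp continuous_inv
  have hflow : Continuous fun p : ℝ × PSU ι N => emb p.2⁻¹ * NormedSpace.exp (p.1 • V) :=
    (hei.comp continuous_snd).mul (hexp.comp continuous_fst)
  have hΦt_cont : ∀ t, Continuous (Φ t) := fun t => hK.mul (hF.continuous.comp (hei.mul continuous_const))
  have hΦ't_cont : ∀ t, Continuous (Φ' t) := fun t =>
    hK.mul ((contDiff_algD hF V).continuous.comp (hei.mul continuous_const))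
  have hΦ'_cont : Continuous fun p : ℝ × PSU ι N => Φ' p.1 p.2 :=
    (hK.comp continuous_snd).mul ((contDiff_algD hF V).continuous.comp hflow)
  obtain ⟨C, hC⟩ : ∃ C, ∀ p ∈ (Metric.closedBall s₀ 1) ×ˢ (Set.univ : Set (PSU ι N)), ‖Φ' p.1 p.2‖ ≤ C :=
    ((isCompact_closedBall s₀ 1).prod isCompact_univ).exists_bound_of_continuousOn hΦ'_cont.continuousOn
  have hderiv : ∀ (h : PSU ι N) (t : ℝ), HasDerivAt (fun s => Φ s h) (Φ' t h) t := fun h t =>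
    (hasDerivAt_comp_mul_exp hF (emb h⁻¹) V t).const_mul (K h)
  have hmain := hasDerivAt_integral_of_dominated_loc_of_deriv_le (μ := μ) (F := Φ) (F' := Φ')
    (x₀ := s₀) (s := Metric.ball s₀ 1) (bound := fun _ => C) (Metric.ball_mem_nhds s₀ one_pos)
    (Eventually.of_forall fun t => (hΦt_cont t).aestronglyMeasurable)
    (integrable_of_continuous_PSU (hΦt_cont s₀) μ) (hΦ't_cont s₀).aestronglyMeasurable
    (ae_of_all _ fun g t ht => hC (t, g) ⟨Metric.ball_subset_closedBall ht, Set.mem_univ _⟩)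
    (integrable_const C) (ae_of_all _ fun g t _ => hderiv g t)
  exact hmain.2

omit [DecidableEq ι] in
/-- **Second derivative of the convolution along the flow**:
`D_V D_V (k ⋆ S)(emb x) = ∫ k(emb x · emb h) (D_V D_V S)(emb h⁻¹) dh` for `V ∈ 𝔰𝔲(N)^ι`. [folklore] -/
theorem algD_algD_polyConv {n : ℕ} {k : Cfg ι N → ℝ} (hk : k ∈ polySpace ι N n) {S : Cfg ι N → ℝ}
    (hS : ContDiff ℝ ∞ S) (V : Cfg ι N) (hV : ∀ e, (V e)ᴴ = -V e) (hV0 : ∀ e, (V e).trace = 0) (x : PSU ι N) :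
    algD V (algD V (polyConv k S)) (emb x) =
      ∫ h, k (emb x * emb h) * algD V (algD V S) (emb h⁻¹) ∂(haarPi ι N) := by
  set μ := haarPi ι N
  have hp : ContDiff ℝ ∞ (polyConv k S) := contDiff_of_mem_polySpace (polyConv_mem hk hS)
  have hK : Continuous fun h : PSU ι N => k (emb x * emb h) :=
    (contDiff_of_mem_polySpace hk).continuous.comp (continuous_const.mul continuous_emb)
  -- (type ascription fixes the instance path of the tree lemma, stated over a general normed algebra)
  have h2 : iteratedDeriv 2 (fun s : ℝ => polyConv k S (emb x * NormedSpace.exp (s • V))) 0 =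
      algD V (algD V (polyConv k S)) (emb x) := iteratedDeriv_two_comp_mul_exp hp (emb x) V
  rw [← h2]
  have hfun : (fun s : ℝ => polyConv k S (emb x * NormedSpace.exp (s • V))) =
      fun s => ∫ h, k (emb x * emb h) * S (emb h⁻¹ * NormedSpace.exp (s • V)) ∂μ :=
    funext fun s => polyConv_mul_exp k S (emb x) V hV hV0 s
  have h1 : deriv (fun s : ℝ => polyConv k S (emb x * NormedSpace.exp (s • V))) =
      fun s => ∫ h, k (emb x * emb h) * algD V S (emb h⁻¹ * NormedSpace.exp (s • V)) ∂μ := by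
    rw [hfun]; exact funext fun s => (hasDerivAt_integral_flow hS hK V s).deriv
  rw [iteratedDeriv_succ, iteratedDeriv_one, h1, (hasDerivAt_integral_flow (contDiff_algD hS V) hK V 0).deriv]
  simp only [zero_smul, NormedSpace.exp_zero, mul_one, μ]

omit [DecidableEq ι] in
/-- Value of the convolution on the group: `(k ⋆ S)(emb x) = ∫ k(emb x · emb h) S(emb h⁻¹) dh`. -/
theorem polyConv_apply (k S : Cfg ι N → ℝ) (x : PSU ι N) :
    polyConv k S (emb x) = ∫ h, k (emb x * emb h) * S (emb h⁻¹) ∂(haarPi ι N) := rfl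

end LatticeBakryEmery

end Summit.Ventures.YMGap

end
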